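import Mathlib
import Literature.MathematicalPhysics.StatisticalMechanics.LennardJonesClusters
import Literature.MathematicalPhysics.StatisticalMechanics.LocalMatchingCompactness
import Summits.AtomisticToContinuum.Crystallization.Theorems.BraggSlacknessRigidityHcpDiffractionRigidityLocalLimitTransferAux

/-!
# Complete windows from essential periodicity (stub `stub_windowsOfEssentialPeriodicity` of crux
# `HcpDiffractionRigidity`, item `stmt-AtomisticToContinuum-13166`, Aux file 1)

The analytic half of stub B2b'. Let `Λ ⊆ ℝ³` be `δ`-separated with `0 ∈ Λ`, `L'_t → ∞`,
`w_t(s) := exp(-|s|²/L'_t²)`, `MG_t := ∑'_{s ∈ Λ} w_t(s)²` and, for a translation `z`,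
`BAD_t(z) := ∑'_{s ∈ Λ, s + z ∉ Λ} w_t(s)²`. If `BAD_t(z) / MG_t → 0` for every `z` in a finite
set `Z`, then for every radius `r` some window `Λ ∩ B(s₀, r)`, `s₀ ∈ Λ`, is *complete*:
`p + z ∈ Λ` for all its points `p` and all `z ∈ Z` (`exists_complete_window`). Bookkeeping: if
every `s₀ ∈ Λ` had a bad pair `(p, z)` in its window, then, comparing `w(s₀)² ≤ e · w(p)²` in
the bulk `|s₀| ≤ L²/(4r) - r` and counting fibres by packing,
`MG ≤ e (2r/δ+1)³ ∑_{z ∈ Z} BAD(z) + TAIL` (`tsum_le_of_forall_bad`) with a uniformly small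
Gaussian tail (`tail_tsum_le`), absurd for `t` large since `MG ≥ w(0)² = 1`. All `[folklore]`.
-/

noncomputable section

namespace Summit.AtomisticToContinuum.Crystallization.Theorems

open Filter Metric Set
open scoped BigOperators Topology Classical
open Literature.MathematicalPhysics.StatisticalMechanics
open Summit.AtomisticToContinuum.Crystallization.Theorems.HcpRigidityLocalLimit

namespace HcpRigidityWindows

local notation "E3" => EuclideanSpace ℝ (Fin 3)

/-! ## Finiteness and packing in a separated set -/

/-- In a `δ`-separated set `Λ ⊆ ℝ³` only finitely many points have norm `≤ R`. [folklore] -/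
theorem finite_norm_le {Λ : Set E3} {δ : ℝ} (hδ : 0 < δ)
    (hΛ : ∀ p ∈ Λ, ∀ q ∈ Λ, p ≠ q → δ ≤ dist p q) (R : ℝ) :
    {s : Λ | ‖(s : E3)‖ ≤ R}.Finite := by
  have hfin : (Λ ∩ closedBall 0 R).Finite :=
    finite_of_forall_le_dist_of_subset_closedBall hδ
      (fun p hp q hq hpq => hΛ p hp.1 q hq.1 hpq) inter_subset_right
  refine (hfin.preimage Subtype.val_injective.injOn).subset fun s hs => ?_
  exact ⟨s.2, mem_closedBall_zero_iff.2 hs⟩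

/-- Packing: a finite family of points of a `δ`-separated set `Λ ⊆ ℝ³`, all within distance `r`
of a point `c`, has at most `(2r/δ + 1)³` members. [folklore] -/
theorem card_le_of_dist_le {Λ : Set E3} {δ : ℝ} (hδ : 0 < δ)
    (hΛ : ∀ p ∈ Λ, ∀ q ∈ Λ, p ≠ q → δ ≤ dist p q) {r : ℝ} (hr : 0 ≤ r) (S : Finset Λ) (c : E3)
    (hS : ∀ a ∈ S, dist (a : E3) c ≤ r) : (S.card : ℝ) ≤ (2 * r / δ + 1) ^ 3 := by
  have h1 : ((S.image (fun a : Λ => (a : E3))).card : ℝ) ≤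
      (2 * r / δ + 1) ^ Module.finrank ℝ E3 := by
    refine card_le_of_separated_of_dist_le _ c hδ hr (fun x hx => ?_) fun x hx y hy hxy => ?_
    · obtain ⟨a, ha, rfl⟩ := Finset.mem_image.1 hx
      exact hS a ha
    · obtain ⟨a, -, rfl⟩ := Finset.mem_image.1 hx
      obtain ⟨b, -, rfl⟩ := Finset.mem_image.1 hy
      exact hΛ _ a.2 _ b.2 hxy
  rwa [finrank_euclideanSpace_fin, Finset.card_image_of_injective _ Subtype.val_injective] at h1

/-! ## The mass inequality when every window is bad -/

/-- **Mass bookkeeping.** Let `Λ ⊆ ℝ³` be `δ`-separated, `g ≥ 0` a weight summable over `Λ` with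
`g(s) ≤ K g(p)` whenever `|s| ≤ R` and `dist p s ≤ r`, and `Z` a finite set of translations. If
EVERY `s₀ ∈ Λ` has a bad pair in its `r`-window (`p ∈ Λ`, `dist p s₀ ≤ r`, `z ∈ Z`, `p + z ∉ Λ`),
then `∑' g ≤ K (2r/δ+1)³ ∑_{z ∈ Z} ∑'_{s : s + z ∉ Λ} g(s) + ∑'_{|s| > R} g(s)`: split off the
tail, bound each bulk term by `K g(p(s₀))`, count fibres of `s₀ ↦ (p(s₀), z(s₀))`. [folklore] -/
theorem tsum_le_of_forall_bad {Λ : Set E3} {δ : ℝ} (hδ : 0 < δ)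
    (hΛ : ∀ p ∈ Λ, ∀ q ∈ Λ, p ≠ q → δ ≤ dist p q) {g : E3 → ℝ} (hg0 : ∀ x, 0 ≤ g x)
    (hgs : Summable fun s : Λ => g s) {r R K : ℝ} (hr : 0 < r) (hK : 0 ≤ K)
    (hcomp : ∀ s ∈ Λ, ∀ p ∈ Λ, ‖s‖ ≤ R → dist p s ≤ r → g s ≤ K * g p) (Z : Finset E3)
    (hbad : ∀ s₀ ∈ Λ, ∃ p ∈ Λ, dist p s₀ ≤ r ∧ ∃ z ∈ Z, p + z ∉ Λ) :
    ∑' s : Λ, g s ≤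
      K * (2 * r / δ + 1) ^ 3 * ∑ z ∈ Z, ∑' s : Λ, (if (s : E3) + z ∈ Λ then (0 : ℝ) else g s) +
        ∑' s : Λ, (if R < ‖(s : E3)‖ then g s else 0) := by
  -- the finite bulk `T` and the finite set `P` of possible bad partners
  set T : Finset Λ := (finite_norm_le hδ hΛ R).toFinset with hTdef
  set P : Finset Λ := (finite_norm_le hδ hΛ (R + r)).toFinset with hPdef
  have hT : ∀ s : Λ, s ∈ T ↔ ‖(s : E3)‖ ≤ R := fun s => by simp [hTdef]
  have hP : ∀ s : Λ, s ∈ P ↔ ‖(s : E3)‖ ≤ R + r := fun s => by simp [hPdef]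
  -- bad partners
  have hbad' : ∀ s₀ : Λ, ∃ p : Λ, dist (p : E3) s₀ ≤ r ∧ ∃ z ∈ Z, (p : E3) + z ∉ Λ := by
    intro s₀
    obtain ⟨p, hp, hd, z, hz, hpz⟩ := hbad s₀ s₀.2
    exact ⟨⟨p, hp⟩, hd, z, hz, hpz⟩
  choose p hpd z hzZ hpz using hbad'
  set φ : Λ → Λ × E3 := fun s => (p s, z s) with hφ
  -- summability of the truncations
  have hdom : ∀ f : Λ → ℝ, (∀ s, 0 ≤ f s ∧ f s ≤ g s) → Summable f := fun f hf =>
    hgs.of_nonneg_of_le (fun s => (hf s).1) fun s => (hf s).2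
  have hbulk_s : Summable fun s : Λ => if ‖(s : E3)‖ ≤ R then g s else 0 :=
    hdom _ fun s => by split_ifs <;> simp [hg0]
  have htail_s : Summable fun s : Λ => if R < ‖(s : E3)‖ then g s else 0 :=
    hdom _ fun s => by split_ifs <;> simp [hg0]
  have hbad_s : ∀ w : E3, Summable fun s : Λ => if (s : E3) + w ∈ Λ then (0 : ℝ) else g s :=
    fun w => hdom _ fun s => by split_ifs <;> simp [hg0]
  -- step 1: split off the tail
  have hsplit : ∑' s : Λ, g s ≤ ∑ s ∈ T, g s + ∑' s : Λ, (if R < ‖(s : E3)‖ then g s else 0) := by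
    have h1 : ∑' s : Λ, g s =
        ∑' s : Λ, ((if ‖(s : E3)‖ ≤ R then g s else 0) + (if R < ‖(s : E3)‖ then g s else 0)) :=
      tsum_congr fun s => by
        by_cases h : ‖(s : E3)‖ ≤ R
        · simp [h, not_lt.2 h]
        · simp [h, not_le.1 h]
    have h2 : ∑' s : Λ, (if ‖(s : E3)‖ ≤ R then g s else 0) = ∑ s ∈ T, g s := by
      rw [tsum_eq_sum (s := T) (fun s hs => if_neg (by rwa [hT] at hs))]
      exact Finset.sum_congr rfl fun s hs => if_pos ((hT s).1 hs)
    rw [h1, hbulk_s.tsum_add htail_s, h2]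
  -- step 2: the bulk terms are dominated by their bad partners
  have hpt : ∀ s ∈ T, g s ≤ K * g (p s : E3) := fun s hs =>
    hcomp _ s.2 _ (p s).2 ((hT s).1 hs) (hpd s)
  -- step 3: fibre counting
  have himage : T.image φ ⊆ P ×ˢ Z := by
    intro y hy
    obtain ⟨a, ha, rfl⟩ := Finset.mem_image.1 hy
    simp only [hφ, Finset.mem_product, hP]
    refine ⟨?_, hzZ a⟩
    have h1 : ‖(a : E3)‖ ≤ R := (hT a).1 ha
    calc ‖((p a : Λ) : E3)‖ = ‖(a : E3) + ((p a : E3) - a)‖ := by congr 1; abel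
      _ ≤ ‖(a : E3)‖ + ‖(p a : E3) - a‖ := norm_add_le _ _
      _ ≤ R + r := by
          have h2 : ‖((p a : Λ) : E3) - a‖ ≤ r := by rw [← dist_eq_norm]; exact hpd a
          linarith
  have hstep3 : ∑ s ∈ T, g (p s : E3) ≤ (2 * r / δ + 1) ^ 3 *
      ∑ y ∈ P ×ˢ Z, (if ((y.1 : Λ) : E3) + y.2 ∈ Λ then (0 : ℝ) else g (y.1 : E3)) := by
    have e3 : ∑ s ∈ T, g (p s : E3) = ∑ y ∈ T.image φ,
        (T.filter (fun a => φ a = y)).card • g ((y.1 : Λ) : E3) :=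
      Finset.sum_comp (fun y : Λ × E3 => g ((y.1 : Λ) : E3)) φ
    rw [e3]
    calc ∑ y ∈ T.image φ, (T.filter (fun a => φ a = y)).card • g ((y.1 : Λ) : E3)
        ≤ ∑ y ∈ T.image φ, (2 * r / δ + 1) ^ 3 *
            (if ((y.1 : Λ) : E3) + y.2 ∈ Λ then (0 : ℝ) else g (y.1 : E3)) := by
          refine Finset.sum_le_sum fun y hy => ?_
          obtain ⟨a, -, hay⟩ := Finset.mem_image.1 hy
          have hy2 : ((y.1 : Λ) : E3) + y.2 ∉ Λ := by rw [← hay]; exact hpz a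
          rw [if_neg hy2, nsmul_eq_mul]
          refine mul_le_mul_of_nonneg_right ?_ (hg0 _)
          refine card_le_of_dist_le hδ hΛ hr.le _ ((y.1 : Λ) : E3) fun c hc => ?_
          have hcy : φ c = y := (Finset.mem_filter.1 hc).2
          have : (y.1 : Λ) = p c := by rw [← hcy]
          rw [this, dist_comm]
          exact hpd c
      _ = (2 * r / δ + 1) ^ 3 * ∑ y ∈ T.image φ,
            (if ((y.1 : Λ) : E3) + y.2 ∈ Λ then (0 : ℝ) else g (y.1 : E3)) := by
          rw [Finset.mul_sum]
      _ ≤ (2 * r / δ + 1) ^ 3 *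
            ∑ y ∈ P ×ˢ Z, (if ((y.1 : Λ) : E3) + y.2 ∈ Λ then (0 : ℝ) else g (y.1 : E3)) := by
          refine mul_le_mul_of_nonneg_left
            (Finset.sum_le_sum_of_subset_of_nonneg himage fun y _ _ => ?_) (by positivity)
          split_ifs; exacts [le_rfl, hg0 _]
  -- step 4: the double sum is a sum of partial sums of the `BAD` series
  have hstep4 : ∑ y ∈ P ×ˢ Z, (if ((y.1 : Λ) : E3) + y.2 ∈ Λ then (0 : ℝ) else g (y.1 : E3)) ≤
      ∑ w ∈ Z, ∑' s : Λ, (if (s : E3) + w ∈ Λ then (0 : ℝ) else g s) := by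
    rw [Finset.sum_product_right]
    refine Finset.sum_le_sum fun w _ => ?_
    exact (hbad_s w).sum_le_tsum P fun s _ => by split_ifs; exacts [le_rfl, hg0 _]
  -- assembly
  have hC : 0 ≤ (2 * r / δ + 1) ^ 3 := by positivity
  calc ∑' s : Λ, g s ≤ ∑ s ∈ T, g s + ∑' s : Λ, (if R < ‖(s : E3)‖ then g s else 0) := hsplit
    _ ≤ K * ∑ s ∈ T, g (p s : E3) + ∑' s : Λ, (if R < ‖(s : E3)‖ then g s else 0) := by
        gcongr
        rw [Finset.mul_sum]
        exact Finset.sum_le_sum hpt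
    _ ≤ K * ((2 * r / δ + 1) ^ 3 * ∑ w ∈ Z, ∑' s : Λ, (if (s : E3) + w ∈ Λ then (0 : ℝ) else g s)) +
          ∑' s : Λ, (if R < ‖(s : E3)‖ then g s else 0) := by
        gcongr
        exact hstep3.trans (mul_le_mul_of_nonneg_left hstep4 hC)
    _ = _ := by ring

/-- The bulk comparison: if `|s| ≤ L²/(4r) - r` and `dist p s ≤ r` then
`exp(-|s|²/L²)² ≤ e · exp(-|p|²/L²)²` (indeed `|p|² - |s|² ≤ 2r · L²/(4r) = L²/2`). [folklore] -/
theorem gauss_sq_le_of_dist_le {L r : ℝ} (hL : 0 < L) (hr : 0 < r) {s p : E3}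
    (hs : ‖s‖ ≤ L ^ 2 / (4 * r) - r) (hps : dist p s ≤ r) :
    Real.exp (-(‖s‖ ^ 2) / L ^ 2) ^ 2 ≤ Real.exp 1 * Real.exp (-(‖p‖ ^ 2) / L ^ 2) ^ 2 := by
  have hn1 : ‖p‖ ≤ ‖s‖ + r := by
    calc ‖p‖ = ‖s + (p - s)‖ := by congr 1; abel
      _ ≤ ‖s‖ + ‖p - s‖ := norm_add_le _ _
      _ ≤ ‖s‖ + r := by rw [← dist_eq_norm]; linarith
  have hn2 : ‖p‖ ≤ L ^ 2 / (4 * r) := by linarith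
  have key : ‖p‖ ^ 2 - ‖s‖ ^ 2 ≤ 2 * r * (L ^ 2 / (4 * r)) := by
    nlinarith [mul_le_mul_of_nonneg_left hn1 (norm_nonneg p),
      mul_le_mul_of_nonneg_left hn2 hr.le, sq_nonneg (‖p‖ - ‖s‖), norm_nonneg s, norm_nonneg p]
  have hρr : 2 * r * (L ^ 2 / (4 * r)) = L ^ 2 / 2 := by field_simp; ring
  rw [hρr] at key
  have hL2 : 0 < L ^ 2 := by positivity
  have exp_sq : ∀ a : ℝ, Real.exp a ^ 2 = Real.exp (2 * a) := fun a => by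
    rw [sq, ← Real.exp_add]; ring_nf
  rw [exp_sq, exp_sq, ← Real.exp_add, Real.exp_le_exp]
  have e1 : 2 * (-(‖s‖ ^ 2) / L ^ 2) = (-2 * ‖s‖ ^ 2) / L ^ 2 := by ring
  have e2 : 1 + 2 * (-(‖p‖ ^ 2) / L ^ 2) = (L ^ 2 - 2 * ‖p‖ ^ 2) / L ^ 2 := by
    field_simp; ring
  rw [e1, e2]
  exact div_le_div_of_nonneg_right (by linarith) hL2.le

/-- The squared Gaussian weights `exp(-|s|²/L²)²` are summable over a `δ`-separated set
`Λ ⊆ ℝ³`. [folklore] -/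
theorem summable_gauss_sq {Λ : Set E3} {δ : ℝ} (hδ : 0 < δ)
    (hΛ : ∀ p ∈ Λ, ∀ q ∈ Λ, p ≠ q → δ ≤ dist p q) {L : ℝ} (hL : 0 < L) :
    Summable fun s : Λ => Real.exp (-(‖(s : E3)‖ ^ 2) / L ^ 2) ^ 2 := by
  obtain ⟨h, -⟩ := summable_gauss hδ hΛ hL
  refine h.of_nonneg_of_le (fun s => by positivity) fun s => ?_
  refine pow_le_of_le_one (Real.exp_pos _).le ?_ two_ne_zero
  calc Real.exp (-(‖(s : E3)‖ ^ 2) / L ^ 2) ≤ Real.exp 0 :=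
        Real.exp_le_exp.2 (div_nonpos_of_nonpos_of_nonneg (neg_nonpos.2 (sq_nonneg _))
          (sq_nonneg _))
    _ = 1 := Real.exp_zero

/-- The Gaussian mass `MG = ∑'_{s ∈ Λ} exp(-|s|²/L²)²` of a separated set containing `0` is at
least `1` (the term `s = 0`). [folklore] -/
theorem one_le_tsum_gauss_sq {Λ : Set E3} {δ : ℝ} (hδ : 0 < δ)
    (hΛ : ∀ p ∈ Λ, ∀ q ∈ Λ, p ≠ q → δ ≤ dist p q) (h0 : (0 : E3) ∈ Λ) {L : ℝ} (hL : 0 < L) :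
    1 ≤ ∑' s : Λ, Real.exp (-(‖(s : E3)‖ ^ 2) / L ^ 2) ^ 2 := by
  have h := (summable_gauss_sq hδ hΛ hL).le_tsum ⟨0, h0⟩ (fun j _ => by positivity)
  simpa using h

/-- **Gaussian tails, squared weights.** For a `δ`-separated finite configuration `y` of `ℝ³`,
`L > 0` and `R ≥ 0`: `∑_{|yᵢ| > R} exp(-|yᵢ|²/L²)² ≤ exp(-R²/L²) · 2(2/δ+1)³(4πL²+1)³`
(one factor `exp(-|yᵢ|²/L²) ≤ exp(-R²/L²)`, the other summed by `sum_gauss_le`). [folklore] -/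
theorem sum_tail_sq_le {N : ℕ} (y : Fin N → E3) {δ : ℝ} (hδ : 0 < δ)
    (hsep : ∀ i j, i ≠ j → δ ≤ dist (y i) (y j)) {L : ℝ} (hL : 0 < L) {R : ℝ} (hR : 0 ≤ R) :
    ∑ i, (if R < ‖y i‖ then Real.exp (-(‖y i‖ ^ 2) / L ^ 2) ^ 2 else 0) ≤
      Real.exp (-(R ^ 2) / L ^ 2) * (2 * (2 / δ + 1) ^ 3 * (4 * Real.pi * L ^ 2 + 1) ^ 3) := by
  have key : ∀ i, (if R < ‖y i‖ then Real.exp (-(‖y i‖ ^ 2) / L ^ 2) ^ 2 else 0) ≤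
      Real.exp (-(R ^ 2) / L ^ 2) * Real.exp (-(‖y i‖ ^ 2) / L ^ 2) := by
    intro i
    split_ifs with h
    · rw [sq]
      refine mul_le_mul_of_nonneg_right ?_ (Real.exp_pos _).le
      rw [Real.exp_le_exp]
      have : R ^ 2 ≤ ‖y i‖ ^ 2 := pow_le_pow_left₀ hR h.le 2
      exact div_le_div_of_nonneg_right (by linarith) (by positivity)
    · positivity
  calc ∑ i, (if R < ‖y i‖ then Real.exp (-(‖y i‖ ^ 2) / L ^ 2) ^ 2 else 0)
      ≤ ∑ i, Real.exp (-(R ^ 2) / L ^ 2) * Real.exp (-(‖y i‖ ^ 2) / L ^ 2) :=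
        Finset.sum_le_sum fun i _ => key i
    _ = Real.exp (-(R ^ 2) / L ^ 2) * ∑ i, Real.exp (-(‖y i‖ ^ 2) / L ^ 2) := by
        rw [Finset.mul_sum]
    _ ≤ _ := mul_le_mul_of_nonneg_left (sum_gauss_le y hδ hsep hL) (Real.exp_pos _).le

/-- The same Gaussian tail bound for the `tsum` over a `δ`-separated set `Λ ⊆ ℝ³`, together with
the summability of the tail. [folklore] -/
theorem tail_tsum_le {Λ : Set E3} {δ : ℝ} (hδ : 0 < δ)
    (hΛ : ∀ p ∈ Λ, ∀ q ∈ Λ, p ≠ q → δ ≤ dist p q) {L : ℝ} (hL : 0 < L) {R : ℝ} (hR : 0 ≤ R) :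
    (Summable fun s : Λ =>
        if R < ‖(s : E3)‖ then Real.exp (-(‖(s : E3)‖ ^ 2) / L ^ 2) ^ 2 else 0) ∧
      ∑' s : Λ, (if R < ‖(s : E3)‖ then Real.exp (-(‖(s : E3)‖ ^ 2) / L ^ 2) ^ 2 else 0) ≤
        Real.exp (-(R ^ 2) / L ^ 2) * (2 * (2 / δ + 1) ^ 3 * (4 * Real.pi * L ^ 2 + 1) ^ 3) :=
  summable_of_forall_sum_le
    (g := fun x : E3 => if R < ‖x‖ then Real.exp (-(‖x‖ ^ 2) / L ^ 2) ^ 2 else 0) hΛ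
    (fun x => by split_ifs; exacts [by positivity, le_rfl])
    fun _ y hs => sum_tail_sq_le y hδ hs hL hR

/-! ## Complete windows exist -/

/-- **Complete windows at a good scale.** The static core of `exists_complete_window`: at a
scale `L ≥ 4r ⊔ 1`, written `L² = 64 r² x` with `x ≥ 1` and `x³ e^{-x} ≤ 1/(4K)`
(`K = 2(2/δ+1)³(256πr²+1)³`, so that the Gaussian tail beyond `L²/(4r) - r` is at most `1/4`),
and with bad series `BAD(z) ≤ η MG` for `z ∈ Z`, `η = 1/(2e(2r/δ+1)³(#Z+1))`, some `s₀ ∈ Λ` has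
a complete `r`-window (else `tsum_le_of_forall_bad` gives `MG ≤ MG/2 + 1/4 < MG`). [folklore] -/
theorem exists_complete_window_of_scale {Λ : Set E3} {δ : ℝ} (hδ : 0 < δ)
    (hΛ : ∀ p ∈ Λ, ∀ q ∈ Λ, p ≠ q → δ ≤ dist p q) (h0 : (0 : E3) ∈ Λ) (Z : Finset E3)
    {r L x K η : ℝ} (hr : 0 < r) (hL1 : 1 ≤ L) (hL4 : 4 * r ≤ L)
    (hL2 : L ^ 2 = 64 * r ^ 2 * x) (hx1 : 1 ≤ x)
    (hK : K = 2 * (2 / δ + 1) ^ 3 * (256 * Real.pi * r ^ 2 + 1) ^ 3)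
    (hx3 : x ^ 3 * Real.exp (-x) ≤ 1 / (4 * K))
    (hη : η = 1 / (2 * (Real.exp 1 * (2 * r / δ + 1) ^ 3) * (Z.card + 1)))
    (hBAD : ∀ z ∈ Z, (∑' s : Λ, if (s : E3) + z ∈ Λ then (0 : ℝ)
        else Real.exp (-(‖(s : E3)‖ ^ 2) / L ^ 2) ^ 2) ≤
      η * ∑' s : Λ, Real.exp (-(‖(s : E3)‖ ^ 2) / L ^ 2) ^ 2) :
    ∃ s₀ ∈ Λ, ∀ p ∈ Λ, dist p s₀ ≤ r → ∀ z ∈ Z, p + z ∈ Λ := by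
  have hL0 : 0 < L := by linarith
  have hC0 : 0 < Real.exp 1 * (2 * r / δ + 1) ^ 3 := by positivity
  have hK0 : 0 < K := by rw [hK]; positivity
  have hη0 : 0 ≤ η := by rw [hη]; positivity
  -- the Gaussian mass is at least one
  have hMG1 := one_le_tsum_gauss_sq hδ hΛ h0 hL0
  -- suppose that every window is bad
  by_contra hcon
  push Not at hcon
  have hmass : ∑' s : Λ, Real.exp (-(‖(s : E3)‖ ^ 2) / L ^ 2) ^ 2 ≤
      Real.exp 1 * (2 * r / δ + 1) ^ 3 * ∑ z ∈ Z, ∑' s : Λ, (if (s : E3) + z ∈ Λ then (0 : ℝ)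
        else Real.exp (-(‖(s : E3)‖ ^ 2) / L ^ 2) ^ 2) +
      ∑' s : Λ, (if L ^ 2 / (4 * r) - r < ‖(s : E3)‖
        then Real.exp (-(‖(s : E3)‖ ^ 2) / L ^ 2) ^ 2 else 0) :=
    tsum_le_of_forall_bad hδ hΛ (g := fun x => Real.exp (-(‖x‖ ^ 2) / L ^ 2) ^ 2)
      (fun x => by positivity) (summable_gauss_sq hδ hΛ hL0) (R := L ^ 2 / (4 * r) - r)
      (K := Real.exp 1) hr (Real.exp_pos 1).le
      (fun s _ p _ hs hps => gauss_sq_le_of_dist_le hL0 hr hs hps) Z hcon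
  -- the bad series are small
  have hsumBAD : ∑ z ∈ Z, (∑' s : Λ, if (s : E3) + z ∈ Λ then (0 : ℝ)
      else Real.exp (-(‖(s : E3)‖ ^ 2) / L ^ 2) ^ 2) ≤
      Z.card * (η * ∑' s : Λ, Real.exp (-(‖(s : E3)‖ ^ 2) / L ^ 2) ^ 2) := by
    calc _ ≤ ∑ z ∈ Z, η * ∑' s : Λ, Real.exp (-(‖(s : E3)‖ ^ 2) / L ^ 2) ^ 2 :=
          Finset.sum_le_sum hBAD
      _ = _ := by rw [Finset.sum_const, nsmul_eq_mul]
  -- the tail is small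
  have hR0 : 0 ≤ L ^ 2 / (4 * r) - r := by
    rw [sub_nonneg, le_div_iff₀ (by positivity)]
    have h16 : 4 * r * (4 * r) ≤ L * L := mul_le_mul hL4 hL4 (by positivity) (by positivity)
    linarith only [h16, sq_nonneg r]
  have htail : ∑' s : Λ, (if L ^ 2 / (4 * r) - r < ‖(s : E3)‖
      then Real.exp (-(‖(s : E3)‖ ^ 2) / L ^ 2) ^ 2 else 0) ≤ 1 / 4 := by
    obtain ⟨-, h⟩ := tail_tsum_le hδ hΛ hL0 hR0
    refine h.trans ?_
    have hRe : L ^ 2 / (4 * r) - r = r * (16 * x - 1) := by rw [hL2]; field_simp; ring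
    have hxx : x ≤ x ^ 2 := by
      rw [sq]; exact le_mul_of_one_le_right (by linarith only [hx1]) hx1
    have h192 : 0 ≤ 192 * x ^ 2 - 32 * x + 1 := by linarith only [hxx, hx1]
    have hxR : x ≤ (L ^ 2 / (4 * r) - r) ^ 2 / L ^ 2 := by
      rw [hRe, hL2, le_div_iff₀ (by positivity)]
      linarith only [mul_nonneg (sq_nonneg r) h192]
    have h1 : Real.exp (-((L ^ 2 / (4 * r) - r) ^ 2) / L ^ 2) ≤ Real.exp (-x) := by
      rw [Real.exp_le_exp, neg_div]; linarith only [hxR]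
    have h2 : (4 * Real.pi * L ^ 2 + 1) ^ 3 ≤ ((256 * Real.pi * r ^ 2 + 1) * x) ^ 3 := by
      refine pow_le_pow_left₀ (by positivity) ?_ 3
      rw [hL2]; linarith only [hx1]
    calc Real.exp (-((L ^ 2 / (4 * r) - r) ^ 2) / L ^ 2) *
          (2 * (2 / δ + 1) ^ 3 * (4 * Real.pi * L ^ 2 + 1) ^ 3)
        ≤ Real.exp (-x) * (2 * (2 / δ + 1) ^ 3 * ((256 * Real.pi * r ^ 2 + 1) * x) ^ 3) :=
          mul_le_mul h1 (mul_le_mul_of_nonneg_left h2 (by positivity)) (by positivity)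
            (by positivity)
      _ = K * (x ^ 3 * Real.exp (-x)) := by rw [hK]; ring
      _ ≤ K * (1 / (4 * K)) := mul_le_mul_of_nonneg_left hx3 hK0.le
      _ = 1 / 4 := by field_simp
  -- contradiction
  have hCη : Real.exp 1 * (2 * r / δ + 1) ^ 3 *
      (Z.card * (η * ∑' s : Λ, Real.exp (-(‖(s : E3)‖ ^ 2) / L ^ 2) ^ 2)) ≤
      (∑' s : Λ, Real.exp (-(‖(s : E3)‖ ^ 2) / L ^ 2) ^ 2) / 2 := by
    have e : Real.exp 1 * (2 * r / δ + 1) ^ 3 *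
        (Z.card * (η * ∑' s : Λ, Real.exp (-(‖(s : E3)‖ ^ 2) / L ^ 2) ^ 2)) =
        (Z.card / (Z.card + 1)) *
          ((∑' s : Λ, Real.exp (-(‖(s : E3)‖ ^ 2) / L ^ 2) ^ 2) / 2) := by
      rw [hη]; field_simp
    rw [e]
    refine mul_le_of_le_one_left (by positivity) ?_
    exact div_le_one_of_le₀ (by linarith) (by positivity)
  have hfin : ∑' s : Λ, Real.exp (-(‖(s : E3)‖ ^ 2) / L ^ 2) ^ 2 ≤
      Real.exp 1 * (2 * r / δ + 1) ^ 3 *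
        (Z.card * (η * ∑' s : Λ, Real.exp (-(‖(s : E3)‖ ^ 2) / L ^ 2) ^ 2)) + 1 / 4 := by
    refine hmass.trans (add_le_add ?_ htail)
    exact mul_le_mul_of_nonneg_left hsumBAD hC0.le
  linarith only [hfin, hCη, hMG1]

/-- **Complete windows exist.** Let `Λ ⊆ ℝ³` be `δ`-separated with `0 ∈ Λ`, `L'_t → ∞`, and `Z` a
finite set of translations with `BAD_t(z) / MG_t → 0` for every `z ∈ Z`. Then for every `r > 0`
some `s₀ ∈ Λ` has a complete `r`-window: `p + z ∈ Λ` for all `p ∈ Λ` with `dist p s₀ ≤ r` and all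
`z ∈ Z` (choose `t` large and apply `exists_complete_window_of_scale`). [folklore] -/
theorem exists_complete_window {Λ : Set E3} {δ : ℝ} (hδ : 0 < δ)
    (hΛ : ∀ p ∈ Λ, ∀ q ∈ Λ, p ≠ q → δ ≤ dist p q) (h0 : (0 : E3) ∈ Λ)
    {L' : ℕ → ℝ} (hL' : Tendsto L' atTop atTop) (Z : Finset E3)
    (hZ : ∀ z ∈ Z, Tendsto (fun t : ℕ => (∑' s : Λ, if (s : E3) + z ∈ Λ then (0 : ℝ)
        else Real.exp (-(‖(s : E3)‖ ^ 2) / L' t ^ 2) ^ 2) /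
      ∑' s : Λ, Real.exp (-(‖(s : E3)‖ ^ 2) / L' t ^ 2) ^ 2) atTop (𝓝 0))
    {r : ℝ} (hr : 0 < r) :
    ∃ s₀ ∈ Λ, ∀ p ∈ Λ, dist p s₀ ≤ r → ∀ z ∈ Z, p + z ∈ Λ := by
  have hη0 : (0 : ℝ) < 1 / (2 * (Real.exp 1 * (2 * r / δ + 1) ^ 3) * (Z.card + 1)) := by
    positivity
  have hK0 : (0 : ℝ) < 1 / (4 * (2 * (2 / δ + 1) ^ 3 * (256 * Real.pi * r ^ 2 + 1) ^ 3)) := by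
    positivity
  -- eventually: small bad ratios, large scale, small `x³e^{-x}`, `x ≥ 1`
  have ev1 : ∀ᶠ t in atTop, ∀ z ∈ Z, (∑' s : Λ, if (s : E3) + z ∈ Λ then (0 : ℝ)
        else Real.exp (-(‖(s : E3)‖ ^ 2) / L' t ^ 2) ^ 2) /
      ∑' s : Λ, Real.exp (-(‖(s : E3)‖ ^ 2) / L' t ^ 2) ^ 2 <
        1 / (2 * (Real.exp 1 * (2 * r / δ + 1) ^ 3) * (Z.card + 1)) :=
    (eventually_all_finset Z).2 fun z hz => (hZ z hz).eventually (gt_mem_nhds hη0)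
  have ev2 : ∀ᶠ t in atTop, max (4 * r) 1 ≤ L' t := hL'.eventually (eventually_ge_atTop _)
  have hx : Tendsto (fun t => L' t ^ 2 / (64 * r ^ 2)) atTop atTop :=
    ((tendsto_pow_atTop two_ne_zero).comp hL').atTop_div_const (by positivity)
  have ev3 : ∀ᶠ t in atTop, (L' t ^ 2 / (64 * r ^ 2)) ^ 3 * Real.exp (-(L' t ^ 2 / (64 * r ^ 2))) <
      1 / (4 * (2 * (2 / δ + 1) ^ 3 * (256 * Real.pi * r ^ 2 + 1) ^ 3)) :=
    ((Real.tendsto_pow_mul_exp_neg_atTop_nhds_zero 3).comp hx).eventually (gt_mem_nhds hK0)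
  have ev4 : ∀ᶠ t in atTop, (1 : ℝ) ≤ L' t ^ 2 / (64 * r ^ 2) :=
    hx.eventually (eventually_ge_atTop 1)
  obtain ⟨t, ht1, ht2, ht3, ht4⟩ := (ev1.and (ev2.and (ev3.and ev4))).exists
  have hL1 : 1 ≤ L' t := (le_max_right _ _).trans ht2
  have hL4 : 4 * r ≤ L' t := (le_max_left _ _).trans ht2
  have hMG1 := one_le_tsum_gauss_sq hδ hΛ h0 (L := L' t) (by linarith)
  refine exists_complete_window_of_scale hδ hΛ h0 Z hr hL1 hL4 (x := L' t ^ 2 / (64 * r ^ 2))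
    (by field_simp) ht4 rfl ht3.le rfl fun z hz => ?_
  have h := ht1 z hz
  rw [div_lt_iff₀ (by linarith)] at h
  exact h.le

end HcpRigidityWindows

/-- **Registered helper stub of `stub_windowsOfEssentialPeriodicity` (Aux file 1): complete
windows exist.** Let `Λ ⊆ ℝ³` be `δ`-separated with `0 ∈ Λ`, `L'_t → ∞`, and `Z` a finite set of
translations such that for every `z ∈ Z` the Gaussian mass of the points `s ∈ Λ` with `s + z ∉ Λ`
is `o`(total Gaussian mass) along the scales `L'_t`. Then for every `r > 0` some `s₀ ∈ Λ` has a
complete `r`-window: `p + z ∈ Λ` for all `p ∈ Λ` with `dist p s₀ ≤ r` and all `z ∈ Z`. [folklore] -/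
theorem stub_windowsOfEssentialPeriodicityCompleteWindow : ∀ δ : ℝ, 0 < δ → ∀ Λ : Set (EuclideanSpace ℝ (Fin 3)), (∀ p ∈ Λ, ∀ q ∈ Λ, p ≠ q → δ ≤ dist p q) → (0 : EuclideanSpace ℝ (Fin 3)) ∈ Λ → ∀ L' : ℕ → ℝ, Filter.Tendsto L' Filter.atTop Filter.atTop → ∀ Z : Finset (EuclideanSpace ℝ (Fin 3)), (∀ z ∈ Z, Filter.Tendsto (fun t : ℕ => (∑' s : Λ, if (s : EuclideanSpace ℝ (Fin 3)) + z ∈ Λ then (0 : ℝ) else Real.exp (-(‖(s : EuclideanSpace ℝ (Fin 3))‖ ^ 2) / L' t ^ 2) ^ 2) / ∑' s : Λ, Real.exp (-(‖(s : EuclideanSpace ℝ (Fin 3))‖ ^ 2) / L' t ^ 2) ^ 2) Filter.atTop (nhds 0)) → ∀ r : ℝ, 0 < r → ∃ s₀ ∈ Λ, ∀ p ∈ Λ, dist p s₀ ≤ r → ∀ z ∈ Z, p + z ∈ Λ :=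
  fun _ hδ _ hΛ h0 _ hL' Z hZ _ hr =>
    HcpRigidityWindows.exists_complete_window hδ hΛ h0 hL' Z hZ hr

end Summit.AtomisticToContinuum.Crystallization.Theorems

end
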